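import Mathlib
import HarnessLib
import Summits.Ventures.LatticeQCDFlow.Exactness.SUNStoutLayerJacobian
import Summits.Ventures.LatticeQCDFlow.Exactness.SUNLeapfrogFTHMCErgodic

/-!
# Field-transformed HMC through the `SU(N)` stout layer is exact and uniformly ergodic, for every `N`

HONEST FRAMING: exact (Metropolis-corrected) sampling algorithms for lattice gauge theory;
figures of merit are autocorrelation/cost numbers at stated couplings and volumes; no
continuum-physics claim.

Venture `LatticeQCDFlow` (cell pub-lqcd), topic `Exactness`; FANOUT row 10 (`eng-equiv`) meeting row 14
(`eng-flowhmc`, `latflow.fthmc`): row 14's `SUNLeapfrogFTHMCErgodic` proves that the engine's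
field-transformed nstep = 1 HMC on `SU(N)^links`, reported through ANY measurable equivalence `F` with
`HasJacobian Haar^⊗ F J`, `0 < j₁ ≤ J ≤ j₂` measurable, is exact for `Z⁻¹e^{−S} Haar^⊗` and uniformly
ergodic — "which maps `F` the engine certifies" was left to the rows typing Jacobians.  This file
supplies the `SU(N)` STOUT layer as such an `F`, for EVERY `N ≥ 1` (`SUNStoutLayerJacobian`: a
continuous positive Jacobian on the compact configuration space is pinched between positive
constants, `SUNStoutLayerJacobian.exists_stoutLayer_fthmc_data`).  No definition is introduced.

* (the data `Ψ, J, j₁, j₂` — `SUNStoutLayerJacobian.exists_stoutLayer_fthmc_data(_of_frozenCoeff)` —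
  are literally the hypotheses `hj₁ hJ₁ hJ₂ hJm hF` of row 14's engine theorems;)
* **`stout_sunLeapfrogFTHMC_uniformlyErgodic`** — CAPSTONE: field-transformed single-step leapfrog
  HMC (engine coordinates `sunCoordι`, kinetic term `−Σ tr P²`, any `ε > 0`, bounded measurable
  momentum increment `g`, bounded measurable action `S`) reported through the `SU(N)` stout layer
  converges to `Z_S⁻¹ e^{−S} Haar^⊗` from EVERY initial law, `|μ₀K̃ᵗ(A) − π_S(A)| ≤ (1 − δ)^{⌊t/(k+1)⌋}`,
  and (`stout_sunLeapfrogFTHMC_invariant_unique`) the Gibbs law is its only invariant probability law.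

Printed counterparts, NAMED ONLY: M. Lüscher, CMP 293 (2010) 899 (FT-HMC); Morningstar–Peardon,
PRD 69 (2004) 054501; Abbott et al., arXiv:2305.02402.
-/

noncomputable section

namespace Summit.Ventures.LatticeQCDFlow.Exactness

open Literature.MathematicalPhysics.QuantumFieldTheory
open Literature.MathematicalPhysics.QuantumFieldTheory.Luscher2010
open Literature.MathematicalPhysics.QuantumFieldTheory.WilsonFlow
open MeasureTheory ProbabilityTheory ProbabilityTheory.Kernel Filter Set
open scoped Matrix Matrix.Norms.Frobenius Topology ENNReal

variable {d L n : ℕ} [NeZero L]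

/-- **FIELD-TRANSFORMED HMC THROUGH THE `SU(N)` STOUT LAYER IS UNIFORMLY ERGODIC**, every `N ≥ 1`,
`d`, `L ≥ 1`: for the constant-parameter masked stout step `Ψ` (`2(d−1)|r| < 1`, h1–h6) there are a
measurable Jacobian `J` (`HasJacobian Haar^⊗ Ψ J`) and constants `k`, `δ ∈ (0, 1]` such that the engine's
single-step leapfrog FT-HMC chain for `S∘Ψ − log J`, reported through `Ψ`, satisfies
`|μ₀K̃ᵗ(A) − π_S(A)| ≤ (1 − δ)^{⌊t/(k+1)⌋}` for every initial law `μ₀`, every `t`, every measurable `A`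
(row 14's `engine_sunLeapfrogFTHMC_uniformlyErgodic` with its `F`, `J` supplied by this row). -/
theorem stout_sunLeapfrogFTHMC_uniformlyErgodic [NeZero n] (p : Edge d L → Prop) [DecidablePred p] (r : ℝ)
    (h1 : ∀ e, p e → ∀ ν, ν ≠ e.2 → ¬p (e.1.shift e.2, ν))
    (h2 : ∀ e, p e → ∀ ν, ν ≠ e.2 → ¬p (e.1.shift ν, e.2))
    (h3 : ∀ e, p e → ∀ ν, ν ≠ e.2 → ¬p (e.1, ν))
    (h4 : ∀ e, p e → ∀ ν, ν ≠ e.2 → ¬p ((e.1 - Pi.single ν 1).shift e.2, ν))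
    (h5 : ∀ e, p e → ∀ ν, ν ≠ e.2 → ¬p (e.1 - Pi.single ν 1, e.2))
    (h6 : ∀ e, p e → ∀ ν, ν ≠ e.2 → ¬p (e.1 - Pi.single ν 1, ν))
    (hr : 2 * (d - 1 : ℝ) * |r| < 1) {ε : ℝ} (hε : 0 < ε)
    {g : GaugeConfig d L (Matrix.specialUnitaryGroup (Fin n) ℂ) → Edge d L → SUNCoords n}
    (hg : Measurable g) {b : ℝ} (hb0 : 0 ≤ b) (hb : ∀ u l, ‖g u l‖ ≤ b)
    {S : GaugeConfig d L (Matrix.specialUnitaryGroup (Fin n) ℂ) → ℝ} (hS : Measurable S) {s : ℝ}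
    (hs : ∀ u, |S u| ≤ s) :
    ∃ (Ψ : GaugeConfig d L (Matrix.specialUnitaryGroup (Fin n) ℂ) ≃ᵐ
        GaugeConfig d L (Matrix.specialUnitaryGroup (Fin n) ℂ))
      (J : GaugeConfig d L (Matrix.specialUnitaryGroup (Fin n) ℂ) → ℝ),
      (⇑Ψ = fun (V : GaugeConfig d L (Matrix.specialUnitaryGroup (Fin n) ℂ)) (e : Edge d L) =>
        if p e then
          (⟨NormedSpace.exp ((r : ℂ) • suProj (plaquetteLoopSum V e.1 e.2)),
              exp_smul_suProj_mem r (plaquetteLoopSum V e.1 e.2)⟩ :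
            Matrix.specialUnitaryGroup (Fin n) ℂ) * V e
        else V e) ∧
      HasJacobian (Measure.pi fun _ : Edge d L => haarProbability (Matrix.specialUnitaryGroup (Fin n) ℂ))
        Ψ (fun v => ENNReal.ofReal (J v)) ∧
      ∃ k : ℕ, ∃ δ : ℝ, 0 < δ ∧ δ ≤ 1 ∧
        ∀ (μ₀ : Measure (GaugeConfig d L (Matrix.specialUnitaryGroup (Fin n) ℂ))) [IsProbabilityMeasure μ₀]
          (t : ℕ) (A : Set (GaugeConfig d L (Matrix.specialUnitaryGroup (Fin n) ℂ))),
          |((fun m : Measure (GaugeConfig d L (Matrix.specialUnitaryGroup (Fin n) ℂ)) =>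
                m.bind (conjKernel (sunLeapfrogHMC (sunCoordι n) (sunCoordι_skew n)
                  (Measure.addHaar : Measure (SUNCoords n)) (sunKinetic n) ε hg
                    fun v => S (Ψ v) - Real.log (J v)) Ψ))^[t] μ₀).real A
              - (gibbsProbability (Measure.pi fun _ : Edge d L =>
                    haarProbability (Matrix.specialUnitaryGroup (Fin n) ℂ)) (fun u => Real.exp (-S u))).real A|
            ≤ (1 - δ) ^ (t / (k + 1)) := by
  obtain ⟨Ψ, J, j₁, j₂, hΨ, hJm, hj₁, hJ₁, hJ₂, hF⟩ := exists_stoutLayer_fthmc_data (n := n) p r h1 h2 h3 h4 h5 h6 hr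
  obtain ⟨k, δ, hδ0, hδ1, hconv⟩ :=
    engine_sunLeapfrogFTHMC_uniformlyErgodic n hε hg hb0 hb hS hs hj₁ hJ₁ hJ₂ hJm hF
  exact ⟨Ψ, J, hΨ, hF, k, δ, hδ0, hδ1, hconv⟩

/-- **… and the Gibbs law `Z_S⁻¹e^{−S} Haar^⊗` is the ONLY invariant probability law of that chain.** -/
theorem stout_sunLeapfrogFTHMC_invariant_unique [NeZero n] (p : Edge d L → Prop) [DecidablePred p] (r : ℝ)
    (h1 : ∀ e, p e → ∀ ν, ν ≠ e.2 → ¬p (e.1.shift e.2, ν))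
    (h2 : ∀ e, p e → ∀ ν, ν ≠ e.2 → ¬p (e.1.shift ν, e.2))
    (h3 : ∀ e, p e → ∀ ν, ν ≠ e.2 → ¬p (e.1, ν))
    (h4 : ∀ e, p e → ∀ ν, ν ≠ e.2 → ¬p ((e.1 - Pi.single ν 1).shift e.2, ν))
    (h5 : ∀ e, p e → ∀ ν, ν ≠ e.2 → ¬p (e.1 - Pi.single ν 1, e.2))
    (h6 : ∀ e, p e → ∀ ν, ν ≠ e.2 → ¬p (e.1 - Pi.single ν 1, ν))
    (hr : 2 * (d - 1 : ℝ) * |r| < 1) {ε : ℝ} (hε : 0 < ε)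
    {g : GaugeConfig d L (Matrix.specialUnitaryGroup (Fin n) ℂ) → Edge d L → SUNCoords n}
    (hg : Measurable g) {b : ℝ} (hb0 : 0 ≤ b) (hb : ∀ u l, ‖g u l‖ ≤ b)
    {S : GaugeConfig d L (Matrix.specialUnitaryGroup (Fin n) ℂ) → ℝ} (hS : Measurable S) {s : ℝ}
    (hs : ∀ u, |S u| ≤ s) :
    ∃ (Ψ : GaugeConfig d L (Matrix.specialUnitaryGroup (Fin n) ℂ) ≃ᵐ
        GaugeConfig d L (Matrix.specialUnitaryGroup (Fin n) ℂ))
      (J : GaugeConfig d L (Matrix.specialUnitaryGroup (Fin n) ℂ) → ℝ),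
      (⇑Ψ = fun (V : GaugeConfig d L (Matrix.specialUnitaryGroup (Fin n) ℂ)) (e : Edge d L) =>
        if p e then
          (⟨NormedSpace.exp ((r : ℂ) • suProj (plaquetteLoopSum V e.1 e.2)),
              exp_smul_suProj_mem r (plaquetteLoopSum V e.1 e.2)⟩ :
            Matrix.specialUnitaryGroup (Fin n) ℂ) * V e
        else V e) ∧
      HasJacobian (Measure.pi fun _ : Edge d L => haarProbability (Matrix.specialUnitaryGroup (Fin n) ℂ))
        Ψ (fun v => ENNReal.ofReal (J v)) ∧
      ∀ (π' : Measure (GaugeConfig d L (Matrix.specialUnitaryGroup (Fin n) ℂ))) [IsProbabilityMeasure π'],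
        Invariant (conjKernel (sunLeapfrogHMC (sunCoordι n) (sunCoordι_skew n)
          (Measure.addHaar : Measure (SUNCoords n)) (sunKinetic n) ε hg fun v => S (Ψ v) - Real.log (J v)) Ψ) π' →
        π' = gibbsProbability (Measure.pi fun _ : Edge d L =>
          haarProbability (Matrix.specialUnitaryGroup (Fin n) ℂ)) (fun u => Real.exp (-S u)) := by
  obtain ⟨Ψ, J, j₁, j₂, hΨ, hJm, hj₁, hJ₁, hJ₂, hF⟩ := exists_stoutLayer_fthmc_data (n := n) p r h1 h2 h3 h4 h5 h6 hr
  exact ⟨Ψ, J, hΨ, hF, fun π' _ hπ' =>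
    engine_sunLeapfrogFTHMC_invariant_unique n hε hg hb0 hb hS hs hj₁ hJ₁ hJ₂ hJm hF hπ'⟩

end Summit.Ventures.LatticeQCDFlow.Exactness

end
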